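import Summits.ABC.IUTFork.Thm311RealInd1StripPacketThetaJunction
import HarnessLib

/-!
# [IUTchIII] Thm 3.11 (i) (Ind1)+(Ind2) ⟶ Cor 3.12 Step (x), reading (P): the `ln ν̄_{𝕃_p}`-level junction — modulo `JannsenWingbergMappingClass`,
# at a prime `p` over which every place of the section is TAME of ODD local degree `≥ 3` with residue degree `≠ 1`, reading (P) of
# [IUTchIII] Cor. 3.12 computed over ANY sub-indeterminacy of the Dupuy–Hilado container containing print's single-factor (Ind1) strip
# moves — e.g. print's factorwise (Ind1)-strip ⊔ (Ind2) group AS TYPED — IS the container's per-image number `−|log(Θ)|^{(P)}_p`;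
# the explicit hull `packetHull(p^{A}·log_p(R_I^×))`, `A = (ord t − 1) div e_j + 1 − (j+1)`; and the NON-VACUITY witness

PROOF-ONLY file (abc-iut cell, Cor. 3.12 sub-crew, seat abc-iut-c312-1 = holder of record of the typed [IUTchIII] Thm. 3.11, gen 16; row
«R21 = C:PACKET-THETA-JUNCTION», file 2; sequel to `Thm311RealInd1StripPacketThetaJunction`).  TAKES NO SIDE on [IUTchIII] Cor. 3.12.  No
definition, no `Prop` fact; `JannsenWingbergMappingClass` is the only conditional input (binder `hMC`).

* §1 `localFields_packetHull_orbitH_pilotRegion_eq_zpow_smul_logPacket_of_jannsenWingbergMappingClass` — the EXPLICIT VALUE at a summand: for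
  `‖t_{i,v_j}‖ = p^{−v/e(v̲_j|p)}` both the `(R_I)^∼`-hull of the `H`-orbit of `O_𝕃(−P_Θ)_{v⃗}` and `slotImagesHull` equal
  `packetHull(p^{A}·log_p(R_I^×))`, `A = (v − 1) div e(v̲_j|p) + 1 − (j+1)` (so the per-image CONTENT of the Θ-region at a tame collection is `A`
  — modulo `hMC` through this route; the container-side inclusion `⊆` is unconditional, file 1 §1).
* §2 **`localFields_lnνLp_hull_orbitH_eq_negLogThetaPerImageAt_of_jannsenWingbergMappingClass`** — if EVERY `v̲ ∣ p` of the section is tame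
  (`p > 2`, `e ≤ p − 2`) of odd local degree `≥ 3` with `f ≠ 1`, then for every family `H = (H_{v⃗})` of subgroups of the packet automorphisms with
  `H_{v⃗} ≤ indTwo` containing the single-factor strip moves (in the degrees `1 ≤ j ≤ ℓ⋆` read by `ln ν̄_{𝕃_p}`):
  `ln ν̄_{𝕃_p}(v⃗ ↦ hull(⋃_{g ∈ H_{v⃗}} g(O_𝕃(−P_Θ)_{v⃗}))) = −|log(Θ)|^{(P)}_p` (gen 15's criterion
  `realPrimePacketWith_lnνLp_hull_orbitH_eq_negLogThetaPerImageAt_of_forall_eq`, p534943 §3, fed with file 1 §2); input level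
  `ThetaVolumeInput.lnνLp_hull_orbitH_eq_negLogThetaPerImageLoc_of_jannsenWingbergMappingClass` (the `p`-summand of `−|log(Θ)|^{(P)}`, Mochizuki's
  shell normalisation `packetAt`).  With abc-iut-c312-d1's monotonicity (p503117) and p516014 §3 this pins, at such primes, the Θ-side of reading
  (P) over print's (Ind1)⊔(Ind2) AS TYPED to the container's — the cells of record decided for `Cor312PerImageOf` transfer verbatim there.
* §3 NON-VACUITY **`exists_subgroup_le_indTwo_stripMoves`** (genuine packet, any index set) — the two hypotheses on `H` are jointly inhabited by a
  group DOMINATED BY PRINT's (Ind1) strip part: the subgroup generated by the single-factor strip moves (a strip automorphism `ψ` is `ℚ_p`-linear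
  by continuity — campaign-S `map_padic_smul_of_continuous` —, so `⊗_i (ψ at i₁, id elsewhere)` is a packet automorphism; it lies in `indTwo` by
  p516014 `mem_indTwo_of_printInd1Ind2`, `ψ ∈ Real.ind1Strip (analyticLogv K)` read `ℚ`-linearly, `galoisLog = analyticLogv`); every element of it
  acts on pure tensors factorwise through the subgroups generated by `Real.ind1Strip ∪ Real.ismIsm` (p516014's `hH` shape).

HONEST SCOPE as in file 1: OUR typings (THE equivariant lift, THE logarithm, factorwise action; F-B28-1 untouched); conditional on `hMC`;
residues `f = 1` / even degree (NOT typed) / wild / `p = 2` displayed by the hypotheses; equal-AS-TYPED ≠ equal in print; nothing here asserts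
that abc is proved or refuted; no side taken. [claim: Mochizuki2012, status: disputed]; [cite: Mochizuki2012, IUTchIII Thm. 3.11 (i) p. 154;
Rmk. 3.9.5 (i) p. 127; Cor. 3.12 Step (x)/(xi) pp. 181–183; IUTchIV Prop. 1.2 (ii) p. 10–11, Prop. 1.4 (i) p. 13]; [cite: Kondo2025OuterAutMLF,
§3 Thm 3.17, Rem 3.18]; [cite: DupuyHilado2025, §4.9, §4.12]. typed ≠ proved; a conditional theorem discharges nothing it binds.
-/

set_option autoImplicit false

noncomputable section

open Metric Set Function
open scoped Pointwise TensorProduct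

namespace Summit.ABC.IUTFork.Thm311.Real

open NumberField IsDedekindDomain Literature.NumberTheory.NumberFields Literature.IUT.LogVolume
open Literature.NumberTheory.GaloisRepresentations Literature.NumberTheory.GaloisRepresentations.Ultrametric
open Literature.AnabelianGeometry.AbsoluteAnabelian Literature.IUT.HodgeArakelov
open Literature.IUT.HodgeArakelov.AbsTopMonoids

/-! ## §1 The explicit value at a summand -/

section PlaceSection

variable {F₀ : Type} [Field F₀] [NumberField F₀] {K : Type} [Field K] [NumberField K] [Algebra F₀ K]
variable (σ : PlaceSection F₀ K) (p : ℕ) [hp : Fact p.Prime]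
variable (c : (j : ℕ) → (Fin (j + 1) → placesOver F₀ p) → ℚ_[p]) (hc0 : ∀ j e, c j e ≠ 0)
  (hcσ : ∀ (j : ℕ) (τ : Equiv.Perm (Fin (j + 1))) (e : Fin (j + 1) → placesOver F₀ p), c j (e ∘ τ) = c j e)

/-- **THE EXPLICIT VALUE (modulo `JannsenWingbergMappingClass`).**  Setting of file 1 §2; if `‖t_{i,v_j}‖ = p^{−v/e(v̲_j|p)}` then BOTH the
`(R_I)^∼`-hull of the `H`-orbit of `O_𝕃(−P_Θ)_{v⃗}` AND the slot-image hull (reading (P)'s region) equal `packetHull(p^{A}·log_p(R_I^×))`,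
`A = (v − 1) div e(v̲_j|p) + 1 − (j+1)` — the per-image content at a tame collection. [claim: Mochizuki2012, status: disputed]
[cite: Mochizuki2012, IUTchIII Cor. 3.12 Step (x) p. 181; IUTchIV Prop. 1.2 (ii) p. 10–11] [cite: DupuyHilado2025, §4.9, §4.12] -/
theorem localFields_packetHull_orbitH_pilotRegion_eq_zpow_smul_logPacket_of_jannsenWingbergMappingClass
    (hMC : JannsenWingbergMappingClass) (hp2 : 2 < p) {lstar : ℕ}
    (t : Fin lstar → (v : placesOver F₀ p) → ((σ.localFields p).k v)ˣ) (i : Fin lstar)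
    (e : Fin ((i : ℕ) + 1 + 1) → placesOver F₀ p)
    (he : ∀ b, absRamificationIdx p ((σ.localFields p).k (e b)) ≤ p - 2)
    (h3 : ∀ b, 3 ≤ localDeg K (σ.lift (e b).1)) (hodd : ∀ b, Odd (localDeg K (σ.lift (e b).1)))
    (hf : ∀ b, (σ.lift (e b).1).asIdeal.inertiaDeg ℤ ≠ 1)
    (H : Subgroup (PacketAlgebra p (fun b => (σ.localFields p).k (e b)) ≃ₗ[ℚ_[p]]
      PacketAlgebra p (fun b => (σ.localFields p).k (e b))))
    (hH : H ≤ indTwo p (fun b => (σ.localFields p).k (e b)))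
    (hstrip : ∀ (b₀ : Fin ((i : ℕ) + 1 + 1)),
      ∀ ψ ∈ ind1StripOf (σ.lift (e b₀).1) (galoisLog (σ.lift (e b₀).1)), ∃ γ ∈ H,
        ∀ z : ∀ b, (σ.localFields p).k (e b),
          (γ : PacketAlgebra p (fun b => (σ.localFields p).k (e b)) ≃ₗ[ℚ_[p]]
              PacketAlgebra p (fun b => (σ.localFields p).k (e b))) (PiTensorProduct.tprod ℚ_[p] z) =
            PiTensorProduct.tprod ℚ_[p] (update z b₀
              (RescaledCompletion.of K p (σ.lift (e b₀).1) (σ.natCast_mem_lift (e b₀))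
                (ψ ((RescaledCompletion.of K p (σ.lift (e b₀).1) (σ.natCast_mem_lift (e b₀))).symm (z b₀))))))
    {v : ℤ} (hv : ‖(t i (e (Fin.last _)) : (σ.localFields p).k (e (Fin.last _)))‖ =
      (p : ℝ) ^ (-(v / (absRamificationIdx p ((σ.localFields p).k (e (Fin.last _))) : ℝ)))) :
    packetHull p (fun b => (σ.localFields p).k (e b))
        (⋃ γ : H, (γ : PacketAlgebra p (fun b => (σ.localFields p).k (e b)) ≃ₗ[ℚ_[p]]
            PacketAlgebra p (fun b => (σ.localFields p).k (e b))) ''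
          (realPrimePacketWith p (σ.localFields p) c hc0 hcσ).pilotRegion t ((i : ℕ) + 1) e) =
      packetHull p (fun b => (σ.localFields p).k (e b))
        (((p : ℚ_[p]) ^ ((v - 1) / (absRamificationIdx p ((σ.localFields p).k (e (Fin.last _))) : ℤ) + 1 -
            Fintype.card (Fin ((i : ℕ) + 1 + 1)))) •
          (logPacket p (fun b => (σ.localFields p).k (e b)) : Set (PacketAlgebra p (fun b => (σ.localFields p).k (e b))))) ∧
    (realPrimePacketWith p (σ.localFields p) c hc0 hcσ).slotImagesHull
        ((realPrimePacketWith p (σ.localFields p) c hc0 hcσ).pilotRegion t) ((i : ℕ) + 1) e =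
      packetHull p (fun b => (σ.localFields p).k (e b))
        (((p : ℚ_[p]) ^ ((v - 1) / (absRamificationIdx p ((σ.localFields p).k (e (Fin.last _))) : ℤ) + 1 -
            Fintype.card (Fin ((i : ℕ) + 1 + 1)))) •
          (logPacket p (fun b => (σ.localFields p).k (e b)) : Set (PacketAlgebra p (fun b => (σ.localFields p).k (e b))))) := by
  have hcore := packetHull_iUnion_image_iota_smul_normalizedPacket_eq_of_jannsenWingbergMappingClass p
    (fun b => σ.lift (e b).1) (fun b => σ.natCast_mem_lift (e b)) hMC hp2 he h3 hodd hf (Fin.last _) hv H hH hstrip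
  have hjun := localFields_packetHull_orbitH_pilotRegion_eq_slotImagesHull_of_jannsenWingbergMappingClass σ p c hc0 hcσ hMC hp2 t i e
    he h3 hodd hf H hH hstrip
  have h1 : packetHull p (fun b => (σ.localFields p).k (e b))
        (⋃ γ : H, (γ : PacketAlgebra p (fun b => (σ.localFields p).k (e b)) ≃ₗ[ℚ_[p]]
            PacketAlgebra p (fun b => (σ.localFields p).k (e b))) ''
          (realPrimePacketWith p (σ.localFields p) c hc0 hcσ).pilotRegion t ((i : ℕ) + 1) e) =
      packetHull p (fun b => (σ.localFields p).k (e b))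
        (((p : ℚ_[p]) ^ ((v - 1) / (absRamificationIdx p ((σ.localFields p).k (e (Fin.last _))) : ℤ) + 1 -
            Fintype.card (Fin ((i : ℕ) + 1 + 1)))) •
          (logPacket p (fun b => (σ.localFields p).k (e b)) : Set (PacketAlgebra p (fun b => (σ.localFields p).k (e b))))) := by
    rw [realPrimePacketWith_pilotRegion_succ_eq]
    exact hcore
  exact ⟨h1, hjun.symm.trans h1⟩

/-! ## §2 The `ln ν̄_{𝕃_p}`-level identity with `−|log(Θ)|^{(P)}_p` -/

/-- **READING (P) OVER PRINT's (Ind1)⊔(Ind2) AS TYPED EQUALS `−|log(Θ)|^{(P)}_p` (modulo `JannsenWingbergMappingClass`; tame, odd local degree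
`≥ 3`, `f ≠ 1` at every place of the section over `p`).**  For the real prime packet over the genuine completions of a place section (any shell
normalisation `c`), a Θ-idele `t`, and any family `H = (H_{j,v⃗})` of subgroups of the packet automorphisms with `H_{j,v⃗} ≤ indTwo` containing the
single-factor (Ind1) strip moves in the degrees `j = i+1 ≤ ℓ⋆`: `ln ν̄_{𝕃_p}(v⃗ ↦ hull(⋃_{g ∈ H_{v⃗}} g(O_𝕃(−P_Θ)_{v⃗}))) = −|log(Θ)|^{(P)}_p`.
[claim: Mochizuki2012, status: disputed] [cite: Mochizuki2012, IUTchIII Thm. 3.11 (i) p. 154; Cor. 3.12 proof Step (x) p. 181]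
[cite: Kondo2025OuterAutMLF, §3 Thm 3.17, Rem 3.18] [cite: DupuyHilado2025, §4.9, §4.12] -/
theorem localFields_lnνLp_hull_orbitH_eq_negLogThetaPerImageAt_of_jannsenWingbergMappingClass
    (hMC : JannsenWingbergMappingClass) (hp2 : 2 < p) {lstar : ℕ}
    (t : Fin lstar → (v : placesOver F₀ p) → ((σ.localFields p).k v)ˣ)
    (he : ∀ v : placesOver F₀ p, absRamificationIdx p ((σ.localFields p).k v) ≤ p - 2)
    (h3 : ∀ v : placesOver F₀ p, 3 ≤ localDeg K (σ.lift v.1)) (hodd : ∀ v : placesOver F₀ p, Odd (localDeg K (σ.lift v.1)))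
    (hf : ∀ v : placesOver F₀ p, (σ.lift v.1).asIdeal.inertiaDeg ℤ ≠ 1)
    (H : (j : ℕ) → (e : Fin (j + 1) → placesOver F₀ p) →
      Subgroup (PacketAlgebra p (fun b => (σ.localFields p).k (e b)) ≃ₗ[ℚ_[p]]
        PacketAlgebra p (fun b => (σ.localFields p).k (e b))))
    (hH : ∀ j e, H j e ≤ indTwo p (fun b => (σ.localFields p).k (e b)))
    (hstrip : ∀ (i : Fin lstar) (e : Fin ((i : ℕ) + 1 + 1) → placesOver F₀ p) (b₀ : Fin ((i : ℕ) + 1 + 1)),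
      ∀ ψ ∈ ind1StripOf (σ.lift (e b₀).1) (galoisLog (σ.lift (e b₀).1)), ∃ γ ∈ H ((i : ℕ) + 1) e,
        ∀ z : ∀ b, (σ.localFields p).k (e b),
          (γ : PacketAlgebra p (fun b => (σ.localFields p).k (e b)) ≃ₗ[ℚ_[p]]
              PacketAlgebra p (fun b => (σ.localFields p).k (e b))) (PiTensorProduct.tprod ℚ_[p] z) =
            PiTensorProduct.tprod ℚ_[p] (update z b₀
              (RescaledCompletion.of K p (σ.lift (e b₀).1) (σ.natCast_mem_lift (e b₀))
                (ψ ((RescaledCompletion.of K p (σ.lift (e b₀).1) (σ.natCast_mem_lift (e b₀))).symm (z b₀)))))) :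
    (realPrimePacketWith p (σ.localFields p) c hc0 hcσ).lnνLp lstar (fun j e =>
        packetHull p (fun b => (σ.localFields p).k (e b))
          (⋃ g : H j e, (g : PacketAlgebra p (fun b => (σ.localFields p).k (e b)) ≃ₗ[ℚ_[p]]
              PacketAlgebra p (fun b => (σ.localFields p).k (e b))) ''
            (realPrimePacketWith p (σ.localFields p) c hc0 hcσ).pilotRegion t j e)) =
      (realPrimePacketWith p (σ.localFields p) c hc0 hcσ).negLogThetaPerImageAt lstar t :=
  realPrimePacketWith_lnνLp_hull_orbitH_eq_negLogThetaPerImageAt_of_forall_eq p (σ.localFields p) c hc0 hcσ t H fun i e =>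
    localFields_packetHull_orbitH_pilotRegion_eq_slotImagesHull_of_jannsenWingbergMappingClass σ p c hc0 hcσ hMC hp2 t i e
      (fun b => he (e b)) (fun b => h3 (e b)) (fun b => hodd (e b)) (fun b => hf (e b)) (H _ e) (hH _ e) (hstrip i e)

end PlaceSection

end Summit.ABC.IUTFork.Thm311.Real

/-! ## §2b Input level: the `p`-summand of `−|log(Θ)|^{(P)}` of a genuine Θ-volume input -/

namespace Literature.IUT.LogVolume.ThetaVolumeInput

open Summit.ABC.IUTFork.Thm311.Real Literature.NumberTheory.NumberFields Function

variable {F₀ : Type} [Field F₀] [NumberField F₀] {K : Type} [Field K] [NumberField K] [Algebra F₀ K]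
variable (I : ThetaVolumeInput F₀ K)

/-- **INPUT LEVEL.**  For a genuine Θ-volume input `I` and a prime `p > 2` over which every place of the section is tame of odd local degree `≥ 3`
with `f ≠ 1`: the `p`-summand of `−|log(Θ)|^{(P)}` (`negLogThetaPerImageLoc I p`, Mochizuki's shell normalisation) EQUALS the reading computed over
any family `H` of subgroups of the packet automorphisms with `H ≤ indTwo` containing the single-factor (Ind1) strip moves — modulo
`JannsenWingbergMappingClass`. [claim: Mochizuki2012, status: disputed] [cite: Mochizuki2012, IUTchIII Cor. 3.12 proof Step (x) p. 181]
[cite: DupuyHilado2025, §4.9, §4.12] -/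
theorem lnνLp_hull_orbitH_eq_negLogThetaPerImageLoc_of_jannsenWingbergMappingClass
    (hMC : Literature.AnabelianGeometry.AbsoluteAnabelian.JannsenWingbergMappingClass) {p : ℕ} (hp : p.Prime) (hp2 : 2 < p)
    (he : haveI : Fact p.Prime := ⟨hp⟩; ∀ v : placesOver F₀ p, absRamificationIdx p ((I.σ.localFields p).k v) ≤ p - 2)
    (h3 : haveI : Fact p.Prime := ⟨hp⟩; ∀ v : placesOver F₀ p, 3 ≤ localDeg K (I.σ.lift v.1))
    (hodd : haveI : Fact p.Prime := ⟨hp⟩; ∀ v : placesOver F₀ p, Odd (localDeg K (I.σ.lift v.1)))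
    (hf : haveI : Fact p.Prime := ⟨hp⟩; ∀ v : placesOver F₀ p, (I.σ.lift v.1).asIdeal.inertiaDeg ℤ ≠ 1)
    (H : haveI : Fact p.Prime := ⟨hp⟩
      (j : ℕ) → (e : Fin (j + 1) → placesOver F₀ p) →
        Subgroup (PacketAlgebra p (fun b => (I.σ.localFields p).k (e b)) ≃ₗ[ℚ_[p]]
          PacketAlgebra p (fun b => (I.σ.localFields p).k (e b))))
    (hH : haveI : Fact p.Prime := ⟨hp⟩; ∀ j e, H j e ≤ indTwo p (fun b => (I.σ.localFields p).k (e b)))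
    (hstrip : haveI : Fact p.Prime := ⟨hp⟩
      ∀ (i : Fin I.lstar) (e : Fin ((i : ℕ) + 1 + 1) → placesOver F₀ p) (b₀ : Fin ((i : ℕ) + 1 + 1)),
        ∀ ψ ∈ ind1StripOf (I.σ.lift (e b₀).1) (galoisLog (I.σ.lift (e b₀).1)), ∃ γ ∈ H ((i : ℕ) + 1) e,
          ∀ z : ∀ b, (I.σ.localFields p).k (e b),
            (γ : PacketAlgebra p (fun b => (I.σ.localFields p).k (e b)) ≃ₗ[ℚ_[p]]
                PacketAlgebra p (fun b => (I.σ.localFields p).k (e b))) (PiTensorProduct.tprod ℚ_[p] z) =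
              PiTensorProduct.tprod ℚ_[p] (update z b₀
                (RescaledCompletion.of K p (I.σ.lift (e b₀).1) (I.σ.natCast_mem_lift (e b₀))
                  (ψ ((RescaledCompletion.of K p (I.σ.lift (e b₀).1) (I.σ.natCast_mem_lift (e b₀))).symm (z b₀)))))) :
    haveI : Fact p.Prime := ⟨hp⟩
    (I.packetAt p hp).lnνLp I.lstar (fun j e =>
        packetHull p (fun b => (I.σ.localFields p).k (e b))
          (⋃ g : H j e, (g : PacketAlgebra p (fun b => (I.σ.localFields p).k (e b)) ≃ₗ[ℚ_[p]]
              PacketAlgebra p (fun b => (I.σ.localFields p).k (e b))) ''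
            (I.packetAt p hp).pilotRegion (I.tΘ p hp) j e)) =
      I.negLogThetaPerImageLoc p := by
  haveI : Fact p.Prime := ⟨hp⟩
  rw [negLogThetaPerImageLoc_of_prime I hp]
  exact localFields_lnνLp_hull_orbitH_eq_negLogThetaPerImageAt_of_jannsenWingbergMappingClass I.σ p (mScale p (I.σ.localFields p))
    (mScale_ne_zero p (I.σ.localFields p)) (mScale_perm p (I.σ.localFields p)) hMC hp2 (I.tΘ p hp) he h3 hodd hf H hH hstrip

end Literature.IUT.LogVolume.ThetaVolumeInput

/-! ## §3 Non-vacuity: the subgroup generated by the single-factor strip moves -/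

namespace Summit.ABC.IUTFork.Thm311.Real

open NumberField IsDedekindDomain Literature.NumberTheory.NumberFields Literature.IUT.LogVolume
open Literature.NumberTheory.GaloisRepresentations Literature.NumberTheory.GaloisRepresentations.Ultrametric
open Literature.AnabelianGeometry.AbsoluteAnabelian Literature.IUT.HodgeArakelov
open Literature.IUT.HodgeArakelov.AbsTopMonoids

section Witness

variable {K : Type} [Field K] [NumberField K] (p : ℕ) [hp : Fact p.Prime]
variable {I : Type} [DecidableEq I] (w : I → HeightOneSpectrum (𝓞 K)) (hw : ∀ i, ((p : ℕ) : 𝓞 K) ∈ (w i).asIdeal)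

/-- **A single-factor strip move is a packet automorphism acting factorwise through print's (Ind1) strip part.**  For `ψ ∈ Real.ind1StripOf w_{i₁}
(galoisLog w_{i₁})` there is `γ ∈ Aut_{ℚ_p}(⊗_i K_{w_i})` with `γ(⊗ z) = ⊗ z[i₁ ↦ ψ z_{i₁}]`, acting on pure tensors through the family `(ψ at i₁,
1 elsewhere)` of elements of the subgroups generated by `Real.ind1Strip (analyticLogv K) w_i ∪ Real.ismIsm (analyticLogv K) w_i` (`ψ` is `ℚ_p`-linear by
continuity; `galoisLog = analyticLogv`). [claim: Mochizuki2012, status: disputed] [cite: Mochizuki2012, IUTchIII Thm. 3.11 (i) p. 154] -/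
theorem exists_linearEquiv_stripMove (i₁ : I) {ψ : (w i₁).adicCompletion K ≃+ (w i₁).adicCompletion K}
    (hψ : ψ ∈ ind1StripOf (w i₁) (galoisLog (w i₁))) :
    ∃ γ : PacketAlgebra p (fun i => RescaledCompletion K p (w i) (hw i)) ≃ₗ[ℚ_[p]]
        PacketAlgebra p (fun i => RescaledCompletion K p (w i) (hw i)),
      (∃ φ : ∀ i, Carrier (.inr (w i) : Thm311.Real.Place K) ≃ₗ[ℚ] Carrier (.inr (w i) : Thm311.Real.Place K),
        (∀ i, φ i ∈ Subgroup.closure (ind1Strip (analyticLogv K) (w i) ∪ ismIsm (analyticLogv K) (w i))) ∧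
        ∀ x : Π i, RescaledCompletion K p (w i) (hw i),
          γ (PiTensorProduct.tprod ℚ_[p] x) = PiTensorProduct.tprod ℚ_[p] (fun i =>
            RescaledCompletion.of K p (w i) (hw i) (φ i ((RescaledCompletion.of K p (w i) (hw i)).symm (x i))))) ∧
      ∀ z : Π i, RescaledCompletion K p (w i) (hw i),
        γ (PiTensorProduct.tprod ℚ_[p] z) = PiTensorProduct.tprod ℚ_[p] (update z i₁
          (RescaledCompletion.of K p (w i₁) (hw i₁) (ψ ((RescaledCompletion.of K p (w i₁) (hw i₁)).symm (z i₁))))) := by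
  classical
  set k := fun i => RescaledCompletion K p (w i) (hw i) with hk
  set e := fun i => RescaledCompletion.of K p (w i) (hw i) with he_def
  obtain ⟨hcont, hcont', _⟩ := id hψ
  -- `ψ` read on the rescaled completion, `ℚ_p`-linear by continuity
  let f : k i₁ ≃+ k i₁ :=
    { toFun := fun a => e i₁ (ψ ((e i₁).symm a))
      invFun := fun a => e i₁ (ψ.symm ((e i₁).symm a))
      left_inv := fun a => by simp only [RingEquiv.symm_apply_apply, AddEquiv.symm_apply_apply, RingEquiv.apply_symm_apply]
      right_inv := fun a => by simp only [RingEquiv.symm_apply_apply, AddEquiv.apply_symm_apply, RingEquiv.apply_symm_apply]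
      map_add' := fun a b => by simp only [map_add] }
  have hfc : Continuous f := hcont
  have hf_smul : ∀ (a : ℚ_[p]) (z : k i₁), f (a • z) = a • f z := fun a z => map_padic_smul_of_continuous p f hfc a z
  let ψQ : k i₁ ≃ₗ[ℚ_[p]] k i₁ := f.toLinearEquiv hf_smul
  -- `ψ` read `ℚ`-linearly on `K_{w_{i₁}}`: an element of print's (Ind1) strip part
  let ψc : Carrier (.inr (w i₁) : Thm311.Real.Place K) ≃+ Carrier (.inr (w i₁) : Thm311.Real.Place K) := ψ
  let ψ' : Carrier (.inr (w i₁) : Thm311.Real.Place K) ≃ₗ[ℚ] Carrier (.inr (w i₁) : Thm311.Real.Place K) :=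
    ψc.toLinearEquiv fun c x => map_rat_smul ψc c x
  have hq : (ψ'.toAddEquiv : (w i₁).adicCompletion K ≃+ (w i₁).adicCompletion K) = ψ := by
    ext x; rfl
  have hψ' : ψ' ∈ ind1Strip (analyticLogv K) (w i₁) := by
    rw [mem_ind1Strip_iff, hq, ← galoisLog_eq_analyticLogv (w i₁)]
    exact hψ
  let φ : ∀ i, Carrier (.inr (w i) : Thm311.Real.Place K) ≃ₗ[ℚ] Carrier (.inr (w i) : Thm311.Real.Place K) :=
    update (fun i => LinearEquiv.refl ℚ _) i₁ ψ'
  refine ⟨PiTensorProduct.congr (update (fun i => LinearEquiv.refl ℚ_[p] (k i)) i₁ ψQ), ⟨φ, fun i => ?_, fun x => ?_⟩, fun z => ?_⟩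
  · by_cases hi : i = i₁
    · subst hi
      simp only [φ, update_self]
      exact Subgroup.subset_closure (Or.inl hψ')
    · simp only [φ, update_of_ne hi]
      exact one_mem _
  · rw [PiTensorProduct.congr_tprod]
    congr 1
    funext i
    by_cases hi : i = i₁
    · subst hi
      simp only [φ, update_self]
      rfl
    · simp only [φ, update_of_ne hi, LinearEquiv.refl_apply]
      exact ((e i).apply_symm_apply (x i)).symm
  · rw [PiTensorProduct.congr_tprod]
    congr 1
    funext i
    by_cases hi : i = i₁
    · subst hi
      simp only [update_self]
      rfl
    · simp only [update_of_ne hi]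
      rfl

/-- **NON-VACUITY of the junction's hypotheses on `H`.**  On the genuine packet `⊗_i K_{w_i}` there is a subgroup `H` of the packet automorphisms
— the one generated by the single-factor (Ind1) strip moves — with `H ≤ indTwo` (the Dupuy–Hilado container), containing every single-factor
strip move, and DOMINATED BY PRINT: every `γ ∈ H` acts on pure tensors factorwise through the subgroups generated by
`Real.ind1Strip (analyticLogv K) w_i ∪ Real.ismIsm (analyticLogv K) w_i` (p516014's `hH` shape).  So the junction applies to a print-(Ind1)
sub-indeterminacy and, by monotonicity, pins every print-dominated family between it and the container. [claim: Mochizuki2012, status: disputed]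
[cite: Mochizuki2012, IUTchIII Thm. 3.11 (i) p. 154] [cite: DupuyHilado2025, §4.9] -/
theorem exists_subgroup_le_indTwo_stripMoves :
    ∃ H : Subgroup (PacketAlgebra p (fun i => RescaledCompletion K p (w i) (hw i)) ≃ₗ[ℚ_[p]]
        PacketAlgebra p (fun i => RescaledCompletion K p (w i) (hw i))),
      H ≤ indTwo p (fun i => RescaledCompletion K p (w i) (hw i)) ∧
      (∀ (i₁ : I), ∀ ψ ∈ ind1StripOf (w i₁) (galoisLog (w i₁)), ∃ γ ∈ H,
        ∀ z : Π i, RescaledCompletion K p (w i) (hw i),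
          (γ : PacketAlgebra p (fun i => RescaledCompletion K p (w i) (hw i)) ≃ₗ[ℚ_[p]]
              PacketAlgebra p (fun i => RescaledCompletion K p (w i) (hw i))) (PiTensorProduct.tprod ℚ_[p] z) =
            PiTensorProduct.tprod ℚ_[p] (update z i₁ (RescaledCompletion.of K p (w i₁) (hw i₁)
              (ψ ((RescaledCompletion.of K p (w i₁) (hw i₁)).symm (z i₁)))))) ∧
      ∀ γ ∈ H, ∃ φ : ∀ i, Carrier (.inr (w i) : Thm311.Real.Place K) ≃ₗ[ℚ] Carrier (.inr (w i) : Thm311.Real.Place K),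
        (∀ i, φ i ∈ Subgroup.closure (ind1Strip (analyticLogv K) (w i) ∪ ismIsm (analyticLogv K) (w i))) ∧
        ∀ x : Π i, RescaledCompletion K p (w i) (hw i),
          (γ : PacketAlgebra p (fun i => RescaledCompletion K p (w i) (hw i)) ≃ₗ[ℚ_[p]]
              PacketAlgebra p (fun i => RescaledCompletion K p (w i) (hw i))) (PiTensorProduct.tprod ℚ_[p] x) =
            PiTensorProduct.tprod ℚ_[p] (fun i =>
              RescaledCompletion.of K p (w i) (hw i) (φ i ((RescaledCompletion.of K p (w i) (hw i)).symm (x i)))) := by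
  classical
  set k := fun i => RescaledCompletion K p (w i) (hw i) with hk
  set e := fun i => RescaledCompletion.of K p (w i) (hw i) with he_def
  -- the print-dominated elements
  let P : (PacketAlgebra p k ≃ₗ[ℚ_[p]] PacketAlgebra p k) → Prop := fun γ =>
    ∃ φ : ∀ i, Carrier (.inr (w i) : Thm311.Real.Place K) ≃ₗ[ℚ] Carrier (.inr (w i) : Thm311.Real.Place K),
      (∀ i, φ i ∈ Subgroup.closure (ind1Strip (analyticLogv K) (w i) ∪ ismIsm (analyticLogv K) (w i))) ∧
      ∀ x : Π i, k i, γ (PiTensorProduct.tprod ℚ_[p] x) = PiTensorProduct.tprod ℚ_[p] (fun i => e i (φ i ((e i).symm (x i))))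
  -- the generators: single-factor strip moves
  let S : Set (PacketAlgebra p k ≃ₗ[ℚ_[p]] PacketAlgebra p k) :=
    {γ | P γ ∧ ∃ (i₁ : I) (ψ : (w i₁).adicCompletion K ≃+ (w i₁).adicCompletion K), ψ ∈ ind1StripOf (w i₁) (galoisLog (w i₁)) ∧
      ∀ z : Π i, k i, γ (PiTensorProduct.tprod ℚ_[p] z) =
        PiTensorProduct.tprod ℚ_[p] (update z i₁ (e i₁ (ψ ((e i₁).symm (z i₁)))))}
  refine ⟨Subgroup.closure S, ?_, ?_, ?_⟩
  · -- `≤ indTwo`: the generators are print-dominated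
    refine (Subgroup.closure_le _).mpr fun γ hγ => ?_
    obtain ⟨⟨φ, hφ, hγφ⟩, -⟩ := hγ
    exact mem_indTwo_of_printInd1Ind2 p w hw φ hφ γ hγφ
  · -- contains the strip moves
    intro i₁ ψ hψ
    obtain ⟨γ, hP, hγ⟩ := exists_linearEquiv_stripMove p w hw i₁ hψ
    exact ⟨γ, Subgroup.subset_closure ⟨hP, i₁, ψ, hψ, hγ⟩, hγ⟩
  · -- every element is print-dominated (closure induction)
    intro γ hγ
    induction hγ using Subgroup.closure_induction with
    | mem γ hγ => exact hγ.1
    | one =>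
      refine ⟨fun _ => 1, fun i => one_mem _, fun x => ?_⟩
      show PiTensorProduct.tprod ℚ_[p] x = _
      exact congrArg (PiTensorProduct.tprod ℚ_[p]) (funext fun i => ((e i).apply_symm_apply (x i)).symm)
    | mul γ γ' _ _ h h' =>
      obtain ⟨φ, hφ, hγ⟩ := h
      obtain ⟨φ', hφ', hγ'⟩ := h'
      refine ⟨fun i => φ i * φ' i, fun i => mul_mem (hφ i) (hφ' i), fun x => ?_⟩
      rw [LinearEquiv.mul_apply, hγ', hγ]
      exact congrArg (PiTensorProduct.tprod ℚ_[p])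
        (funext fun i => congrArg (fun y => e i (φ i y)) ((e i).symm_apply_apply _))
    | inv γ _ h =>
      obtain ⟨φ, hφ, hγ⟩ := h
      refine ⟨fun i => (φ i)⁻¹, fun i => inv_mem (hφ i), fun x => ?_⟩
      have hx := hγ (fun i => e i ((φ i)⁻¹ ((e i).symm (x i))))
      have hx' : (fun i => e i (φ i ((e i).symm (e i ((φ i)⁻¹ ((e i).symm (x i))))))) = x := by
        funext i
        rw [RingEquiv.symm_apply_apply, show φ i ((φ i)⁻¹ ((e i).symm (x i))) = (e i).symm (x i) from
          LinearEquiv.apply_symm_apply (φ i) _, RingEquiv.apply_symm_apply]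
      rw [hx'] at hx
      rw [← hx]
      exact γ.symm_apply_apply _

end Witness

end Summit.ABC.IUTFork.Thm311.Real

end
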